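import Mathlib
import HarnessLib
import Literature.Computability.Complexity.Promise
import Literature.Computability.MetaComplexity.HeuristicClasses
import Literature.Computability.Cryptography.OneWayFunctions
import Literature.InformationTheory.Entropy.MapEntropy

/-!
# Sketch for crux-ideate cards on `PeaWorstToAvg` (stmt-PneNP-10777), ideator 2, round 1

First lemmas of the two idea cards, stated over existing tree declarations:

* card `dti-errorless-core`: `OnPromise`, `ErrorlessHardAE`, `ErrorlessHard`,
  `instInvertProb`, `DecisionToInversion`, the bridge `owfExist_of_errorlessHardAE_of_dti`
  (Liu–Mazor–Pass 2024 Lemma 3.1 / Chakraborty–Hulett–Khurana–Tomer 2026 Lemma 2, abstract form)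
  and the comparison `errorlessHard_of_heurHard` with the crux's conclusion;
* card `lattice-import-trapdoor-support`: `mixEnsemble`, `mem_HeurBPP_of_mixture` (union-bound
  transfer along DGRV's ≤2-query tt-completeness reduction) and
  `heurHard_pea_of_heurHard_of_reducible` (push-forward of a hard on-promise ensemble);
* artefacts of the session's barrier notes (NOTES.md B5/B10): `mapEntropy_le_fst_add_snd`
  (subadditivity, the entropy-defect certificate of a biased output functional — the planted
  sparse-dual-word ensemble it served is killed quantitatively in B10) and the exact one-time-pad
  bookkeeping `mapEntropy_otp` (answer-preserving junk outputs), the latter PROVED.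

Nothing here is a proof of the crux; `sorry` marks statements the line must prove.
-/

namespace Summit.PneNP.PneNP.Cruxes.PeaWorstToAvg.IdeaSketch

open Literature.Computability.Complexity Literature.Computability.MetaComplexity
open Literature.Computability.Cryptography
open _root_.Computability

noncomputable section

/-- `PEA d`, verbatim the route's inline spelling (binder `n` of `ev` renamed to `_`). -/
def PEA (d : ℕ) : PromiseProblem :=
  let ev : (n : ℕ) → List (List (List (Fin n))) → (Fin n → ZMod 2) → List (ZMod 2) :=
    fun _ P x => P.map fun p => (p.map fun μ => (μ.map x).prod).sum
  let H : (Σ n : ℕ, List (List (List (Fin n))) × ℕ) → ℝ := fun I =>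
    (∑ x : Fin I.1 → ZMod 2, Real.logb 2 (((Finset.univ : Finset (Fin I.1 → ZMod 2)).card : ℝ) /
      (Finset.univ.filter fun x' : Fin I.1 → ZMod 2 => ev I.1 I.2.1 x' = ev I.1 I.2.1 x).card)) /
      (Finset.univ : Finset (Fin I.1 → ZMod 2)).card
  PromiseProblem.ofEncoding
    (Computability.Encoding.sigmaBool fun n =>
      ((encodingFinBool n).listBool.listBool.listBool).pairBool Computability.encodingNatBool)
    {I : (Σ n : ℕ, List (List (List (Fin n))) × ℕ) |
      (∀ p ∈ I.2.1, ∀ μ ∈ p, μ.length ≤ d) ∧ (I.2.2 : ℝ) + 1 ≤ H I}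
    {I : (Σ n : ℕ, List (List (List (Fin n))) × ℕ) |
      (∀ p ∈ I.2.1, ∀ μ ∈ p, μ.length ≤ d) ∧ H I ≤ (I.2.2 : ℝ)}

/-! ## Card `dti-errorless-core` -/

/-- The ensemble is supported on the promise of `Q`. -/
def OnPromise (Q : PromiseProblem) (D : Ensemble) : Prop :=
  ∀ n, ∀ w ∈ (D n).support, w ∈ Q.yes ∨ w ∈ Q.no

/-- The crux's conclusion (two-sided average-case hardness of `Q` itself on a samplable
on-promise ensemble), abstracted over the promise problem. -/
def HeurHard (Q : PromiseProblem) : Prop :=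
  ∃ D : Ensemble, D.IsPolySamplable ∧ OnPromise Q D ∧ DistProblem.mk Q.yes D ∉ HeurBPP

/-- K1, plain form: ERRORLESS (`AvgBPP`) average-case hardness of `Q` itself on a samplable
on-promise ensemble. -/
def ErrorlessHard (Q : PromiseProblem) : Prop :=
  ∃ D : Ensemble, D.IsPolySamplable ∧ OnPromise Q D ∧ DistProblem.mk Q.yes D ∉ AvgBPP

/-- K1, almost-everywhere / fixed-constant form (negation of `ioAvgBPP`-type easiness, uniform
version of Chakraborty–Hulett–Khurana–Tomer 2026 Def. 9): some samplable on-promise `D` such that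
every polynomial-time `{0,1,⊥}`-valued algorithm that is errorless on `supp Dₙ` outputs `⊥` on
more than a quarter of `Dₙ` for all large `n`. -/
def ErrorlessHardAE (Q : PromiseProblem) : Prop :=
  ∃ D : Ensemble, D.IsPolySamplable ∧ OnPromise Q D ∧
    ∀ A : RandAlg (List Bool × ℕ) (Option Bool), A.IsPolyTime paramEnc optBoolEnc →
      (∀ n : ℕ, ∀ x ∈ (D n).support,
        A.pr paramEnc (x, n) {some (!(Q.yes.boolIndicator x))} ≤ 1 / 4) →
      ∀ᶠ n in Filter.atTop, (1 : ℝ) / 4 < D.prob n {x | 1 / 4 ≤ A.pr paramEnc (x, n) {none}}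

/-- Success probability of `A` at inverting the instance-indexed function `fam I` on a uniform
input of length `ℓ(|I|)`, given the instance: `Pr_{z ← U_ℓ}[fam I (A(I, fam I z)) = fam I z]`. -/
def instInvertProb (fam : List Bool → List Bool → List Bool) (ℓ : Polynomial ℕ)
    (A : RandAlg (List Bool) (List Bool)) (I : List Bool) : ℝ :=
  uniformAvg (ℓ.eval I.length) fun z => A.pr id (boolPair I (fam I z)) {w | fam I w = fam I z}

/-- **Decision-to-inversion reduction** for `Q` along the instance-indexed family `fam`
(Chakraborty–Hulett–Khurana–Tomer 2026 Def. 10, after Liu–Mazor–Pass 2024; here in the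
`∀ A ∃ B` form with a near-perfect inverter, which is what the bridge below consumes): every PPT
`A` that inverts `fam I` with probability `≥ 1 - 1/q₀(|I|)` on a promise instance `I` yields a PPT
decision `B` correct on `I` with probability `≥ 2/3`. -/
def DecisionToInversion (Q : PromiseProblem) (fam : List Bool → List Bool → List Bool)
    (ℓ q₀ : Polynomial ℕ) : Prop :=
  ∀ A : RandAlg (List Bool) (List Bool), IsPPT A id →
    ∃ B : RandAlg (List Bool) Bool, IsPPT B encodeBool ∧
      ∀ I : List Bool, (I ∈ Q.yes ∨ I ∈ Q.no) →
        1 - 1 / ((q₀.eval I.length : ℕ) : ℝ) ≤ instInvertProb fam ℓ A I →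
          (I ∈ Q.yes → 2 / 3 ≤ B.pr id I {true}) ∧ (I ∈ Q.no → 2 / 3 ≤ B.pr id I {false})

/-- `Q` has a decision-to-inversion reduction along SOME polynomial-time family. -/
def HasDTI (Q : PromiseProblem) : Prop :=
  ∃ (F : List Bool → List Bool) (fam : List Bool → List Bool → List Bool) (ℓ q₀ : Polynomial ℕ),
    PolyTimeComputable id id F ∧ (∀ I z, F (boolPair I z) = boolPair I (fam I z)) ∧
    (∀ n, 0 < q₀.eval n) ∧ DecisionToInversion Q fam ℓ q₀

/-- K2 of the card: PEA₃ has a decision-to-inversion reduction (candidate family: hashed direct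
powers `z ↦ h(p^{×t}(z))` of the instance's own map together with its restrictions, inverted
distributionally via Impagliazzo–Luby and counted à la Jerrum–Valiant–Vazirani). -/
def PeaHasDTI : Prop := HasDTI (PEA 3)

/-- K1 of the card (errorless core): worst-case hardness of PEA₃ gives errorless average-case
hardness of PEA₃ itself. -/
def PeaWorstToErrorless : Prop := PEA 3 ∉ PromiseBPP' → ErrorlessHard (PEA 3)

/-- K1, almost-everywhere variant (pairs with `OWFExist` in the bridge). -/
def PeaWorstToErrorlessAE : Prop := PEA 3 ∉ PromiseBPP' → ErrorlessHardAE (PEA 3)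

/-- **Bridge (K3)** [Liu–Mazor–Pass 2024, Lemma 3.1; Chakraborty–Hulett–Khurana–Tomer 2026,
Lemma 2 and App. B], abstract form over the tree's `OWFExist`: almost-everywhere errorless
hardness of `Q` on a samplable ensemble plus a decision-to-inversion reduction for `Q` give
one-way functions (candidate `F'(r, z) = (I, fam I z)` with `I` the sampler's output on coins `r`;
if `F'` is not even weakly one-way — `weakOWFExist_iff_OWFExist_holds` — the inverter is
near-perfect on most `I` infinitely often, and "estimate the inverter's success on `I`, then run
`B` or output `⊥`" is an errorless algorithm with few `⊥`s). First checkable statement of the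
line; to be proved. -/
theorem owfExist_of_errorlessHardAE_of_dti (Q : PromiseProblem)
    (hH : ErrorlessHardAE Q) (hD : HasDTI Q) : OWFExist := by
  sorry

/-- Sanity comparison with the crux: its conclusion (two-sided hardness) implies K1's conclusion
(errorless hardness), through the tree fact `AvgBPP ⊆ HeurBPP`. -/
theorem errorlessHard_of_heurHard (h : AvgBPP_subset_HeurBPP) (Q : PromiseProblem) :
    HeurHard Q → ErrorlessHard Q := by
  rintro ⟨D, hS, hP, hD⟩
  exact ⟨D, hS, hP, fun hA => hD (h hA)⟩

/-! ## Entropy bookkeeping artefacts (barrier notes B5/B10; used by both cards' clouds) -/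

open Literature.InformationTheory.Entropy in
/-- **Entropy-defect certificate (NO side).** For any map `P : ι → G × ZMod 2` (think: the last
coordinate is the planted sparse dual functional `h₀ · (sG + e)` of a noisy-codeword sampler,
split off by a linear isomorphism), Shannon subadditivity bounds the entropy of `P` by the entropy
of the first component plus the (binary) entropy of the biased bit. With
`bias = (1-2τ)^{wt h₀}` this is the `1/poly` entropy DEFECT the PEA₃ instance must detect.
To be proved (chain rule / subadditivity is not yet in the `mapEntropy` API). -/
theorem mapEntropy_le_fst_add_snd {ι G : Type*} [Fintype ι] [DecidableEq G] [Nonempty ι]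
    (P : ι → G × ZMod 2) :
    mapEntropy Finset.univ P ≤
      mapEntropy Finset.univ (fun v => (P v).1) + mapEntropy Finset.univ (fun v => (P v).2) := by
  sorry

open Literature.InformationTheory.Entropy in
/-- **Exact one-time-pad bookkeeping.** Appending outputs `w + g x` with fresh uniform `w` adds
exactly `log₂ |W|` bits of entropy, whatever `g` is:
`H((f X, W + g X)) = H(f X) + log₂ |W|`. (Used by both cards: answer-preserving padding of
instances with junk outputs; proved here from the tree's `mapEntropy` API.) -/
theorem mapEntropy_otp {ι W β : Type*} [Fintype ι] [Fintype W] [Nonempty ι] [Nonempty W]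
    [AddCommGroup W] [DecidableEq β] [DecidableEq W] (f : ι → β) (g : ι → W) :
    mapEntropy Finset.univ (fun p : ι × W => (f p.1, p.2 + g p.1)) =
      mapEntropy Finset.univ f + Real.logb 2 (Fintype.card W) := by
  -- re-index the sample space by the shear `(x, w) ↦ (x, w + g x)`
  let e : ι × W ≃ ι × W :=
    { toFun := fun p => (p.1, p.2 + g p.1)
      invFun := fun p => (p.1, p.2 - g p.1)
      left_inv := fun p => by simp
      right_inv := fun p => by simp }
  have h1 : (fun p : ι × W => (f p.1, p.2 + g p.1)) = (Prod.map f id) ∘ e := by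
    funext p; rfl
  rw [h1, mapEntropy_univ_comp_equiv e (Prod.map f (id : W → W))]
  have h2 : (Finset.univ : Finset (ι × W)) = (Finset.univ : Finset ι) ×ˢ (Finset.univ : Finset W) :=
    Finset.univ_product_univ.symm
  rw [h2, mapEntropy_product Finset.univ_nonempty Finset.univ_nonempty f (id : W → W),
    mapEntropy_of_injective _ Function.injective_id, Finset.card_univ]


/-! ## Card `lattice-import-trapdoor-support` -/

/-- Fair mixture of two ensembles (a fair coin, then a sample of the chosen one). -/
def mixEnsemble (D₁ D₂ : Ensemble) : Ensemble := fun n =>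
  (PMF.bernoulli (1 / 2) (by norm_num)).bind fun b => if b then D₁ n else D₂ n

/-- **Union-bound transfer for truth-table completeness reductions (average-case plumbing).**
A heuristic scheme for `L` under the fair mixture of `D₁` and `D₂` is a heuristic scheme for `L`
under each component (run it with error parameter `2m`: the component error is at most twice
the mixture error). This is the step that lands ONE samplable ensemble over PEA₃ instances from
the two query-marginals of DGRV's `≤ 2`-query truth-table completeness reduction. To be proved
(needs the `m ↦ 2m` re-parametrisation plumbing of `RandAlg` schemes). -/
theorem mem_HeurBPP_of_mixture (L : Language Bool) (D₁ D₂ : Ensemble)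
    (h : DistProblem.mk L (mixEnsemble D₁ D₂) ∈ HeurBPP) :
    DistProblem.mk L D₁ ∈ HeurBPP ∧ DistProblem.mk L D₂ ∈ HeurBPP := by
  sorry

/-- The card's target in abstract form: if some promise problem `Q` Karp-reduces to PEA₃
(`PromiseProblem.PolyTimeReducible`, on-promise images) and is two-sided hard on a samplable
on-promise ensemble, then so is PEA₃ (push the ensemble forward). With `Q` = trapdoor-certified
gap-BDD on `q`-ary lattices, hard on average under worst-case `GapSVP` via
`blprs_gapSVP_sqrt_dim_to_lwe_classical` / `peikert_gapSVPZeta_to_lwe_classical`, this discharges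
the crux's conclusion in the lattice-hard world. To be proved from the tree's
`mem_HeurBPP_of_polyTimeReducible` pattern plus samplability of push-forwards. -/
theorem heurHard_pea_of_heurHard_of_reducible (Q : PromiseProblem)
    (hred : Q.PolyTimeReducible (PEA 3)) (hQ : HeurHard Q) : HeurHard (PEA 3) := by
  sorry

end

end Summit.PneNP.PneNP.Cruxes.PeaWorstToAvg.IdeaSketch
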